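import Summits.KontsevichZagierPeriods.KontsevichZagierPeriods.Theorems.ValuedFieldSpecialisationCTConstructionSortedTypedElementary
import Summits.KontsevichZagierPeriods.KontsevichZagierPeriods.Theorems.ValuedFieldSpecialisationCTConstructionBlowupSplit
import Summits.KontsevichZagierPeriods.KontsevichZagierPeriods.Theorems.ValuedFieldSpecialisationClassLevelExpansionFibreDimOneMonomial

/-!
# Route ValuedFieldSpecialisation — crux `CTConstruction`: a `β`-typed piece of type `S` is an elementary product over the fibre representation

Helper toward crux stmt-KontsevichZagierPeriods-3495 (`CTConstruction`), line `registered`,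
reshape r4 (blow-up elimination of the log block), stub `stub_blowup_sorted`. A **typed family**
over the elementary data `(p, q, B, d, r)` of type `S ⊆ Fin B` is a representation
`R : KZ.IntegralRep (B + d + 3)` with coordinates `z = (σ, s', v, t, w)` (`σ = z 0` the parameter,
`s' = z 1`, `v = z 2`, the block `t : Fin B → ℝ` at the indices `(Fin.castAdd d j).succ.succ.succ`,
the fibre `w : Fin d → ℝ` at the indices `(Fin.natAdd B l).succ.succ.succ`), domain `0 < σ < 1`,
`0 < s' < 1`, `0 < v`, `v ^ q σ ^ p < 1`, `s' ≤ t j ≤ 1` for `j ∈ S`, `σ ≤ t j ≤ 1` for `j ∉ S`,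
`w ∈ r.domain`, and integrand `s' ^ (1 - p/q) · ∏ (t j)⁻¹ · r.integrand w`. The **fibre
representation** `W : KZ.IntegralRep (m + d + 1)` (`m = #S`) has coordinates `(s', η, x)`, domain
`0 < s' < 1`, `s' ≤ η l ≤ 1`, `x ∈ r.domain`, integrand `s' ^ (1 - p/q) · ∏ (η l)⁻¹ · r(x)`.
After RELABELLING COORDINATES — `σ ↦ s`, `v ↦ u`, `t|_{Sᶜ} ↦ y` (along an enumeration of `Sᶜ`),
`(s', t|_S, w) ↦ (s', η, x)` (along an enumeration of `S`) — `R` is LITERALLY the elementary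
divergent product `E_{p/q, B - m}` over `W`: domain `0 < s < 1`, `0 < u`, `u ^ q s ^ p < 1`,
`s ≤ y j ≤ 1`, `(s', η, x) ∈ W.domain`, integrand `∏ (y j)⁻¹ · W.integrand (s', η, x)`. The
relabelling `e : Fin (B + d + 3) ≃ Fin ((B - m) + (m + d + 1) + 2)` fixes the parameter index `0`,
so it is a FIBRED move (`of_sub_of_reindex_mem_fibredRelations_of_pos`):
`[R] − [R.reindex e] ∈ KZ.fibredRelations`, and the data of `R.reindex e` are those of the
elementary product on the nose (domains through their coordinate forms `blowupTypedDomainAC_eq`,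
`elementaryDomain_eq`, `monomialDomain_eq`; the product `∏_{Fin B}` splits along
`Fin (B - m) ⊕ Fin m ≃ Fin B`, `Fintype.prod_sum_type`). Pure index bookkeeping, no analysis.

Sources: M. Kontsevich, D. Zagier, *Periods* (2001), §1.2 (rule (2), change of variables);
J. Bochnak, M. Coste, M.-F. Roy, *Real Algebraic Geometry* (1998), §2.2 (semialgebraic maps, used
through the reindexing move of `KZProductIdeal`). No new definitions.
-/

noncomputable section

namespace Summit.KontsevichZagierPeriods.ValuedFieldSpecialisation

open MeasureTheory Set Filter
open scoped Topology
open Literature.NumberTheory.Transcendental Literature.NumberTheory.Transcendental.KZ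

/-! ## Enumerating `S` and its complement -/

/-- **Sorting a finite set of indices.** For `S : Finset (Fin B)` with `#S = m` there is a
bijection `Fin (B - m) ⊕ Fin m ≃ Fin B` sending the left summand into the complement of `S` and
the right summand into `S` (`Equiv.sumCompl` composed with enumerations of the two subtypes).
[folklore] -/
theorem exists_sumEquiv_finsetCompl {B m : ℕ} (S : Finset (Fin B)) (hm : S.card = m) :
    ∃ ψ : Fin (B - m) ⊕ Fin m ≃ Fin B, (∀ j, ψ (Sum.inl j) ∉ S) ∧ ∀ l, ψ (Sum.inr l) ∈ S := by
  have eS : {j : Fin B // j ∈ S} ≃ Fin m := Fintype.equivFinOfCardEq (by simp [hm])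
  have eC : {j : Fin B // j ∉ S} ≃ Fin (B - m) := Fintype.equivFinOfCardEq (by simp [hm])
  exact ⟨(Equiv.sumCongr eC.symm eS.symm).trans
      ((Equiv.sumComm _ _).trans (Equiv.sumCompl fun j : Fin B => j ∈ S)),
    fun j => (eC.symm j).2, fun l => (eS.symm l).2⟩

/-! ## The relabelling of coordinates -/

/-- **The relabelling `Fin (B + d + 3) ≃ Fin ((B - m) + (m + d + 1) + 2)`** of the coordinates of a
typed family of type `S` (given through a sorting `ψ : Fin (B - m) ⊕ Fin m ≃ Fin B` of the block,
left summand = `Sᶜ`, right summand = `S`) onto the coordinates `(s, u, y, (s', η, x))` of the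
elementary product over the fibre representation: `σ = z 0 ↦ 0`, `s' = z 1 ↦` the first fibre
coordinate, `v = z 2 ↦ 1`, `t (ψ (inl j)) ↦ y j`, `t (ψ (inr l)) ↦ η l`, `w i ↦ x i`. It is the
inverse of the explicit map in the other direction, which is a bijection by surjectivity and a
count of indices. [folklore] -/
theorem exists_blowupSortedEquiv {B m : ℕ} (d : ℕ) (ψ : Fin (B - m) ⊕ Fin m ≃ Fin B) :
    ∃ e : Fin (B + d + 1 + 1 + 1) ≃ Fin ((B - m) + (m + d + 1) + 1 + 1),
      e 0 = 0 ∧ e 1 = (Fin.natAdd (B - m) (0 : Fin (m + d + 1))).succ.succ ∧ e 2 = 1 ∧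
      (∀ j : Fin (B - m), e (Fin.castAdd d (ψ (Sum.inl j))).succ.succ.succ =
        (Fin.castAdd (m + d + 1) j).succ.succ) ∧
      (∀ l : Fin m, e (Fin.castAdd d (ψ (Sum.inr l))).succ.succ.succ =
        (Fin.natAdd (B - m) (Fin.castAdd d l).succ).succ.succ) ∧
      (∀ i : Fin d, e (Fin.natAdd B i).succ.succ.succ =
        (Fin.natAdd (B - m) (Fin.natAdd m i).succ).succ.succ) := by
  -- `m ≤ B`, read off from `ψ`
  have hmB : B - m + m = B := by
    simpa only [Fintype.card_sum, Fintype.card_fin] using Fintype.card_congr ψ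
  -- the explicit map in the other direction (target index ↦ source index)
  obtain ⟨g, hg⟩ : ∃ g : Fin ((B - m) + (m + d + 1) + 1 + 1) → Fin (B + d + 1 + 1 + 1),
      g = Matrix.vecCons 0 (Matrix.vecCons 2 (Fin.append
        (fun j : Fin (B - m) => (Fin.castAdd d (ψ (Sum.inl j))).succ.succ.succ)
        (Matrix.vecCons 1 (Fin.append
          (fun l : Fin m => (Fin.castAdd d (ψ (Sum.inr l))).succ.succ.succ)
          (fun i : Fin d => (Fin.natAdd B i).succ.succ.succ))))) := ⟨_, rfl⟩
  have hg0 : g 0 = 0 := by simp [hg]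
  have hg1 : g 1 = 2 := by simp [hg]
  have hgs : g (Fin.natAdd (B - m) (0 : Fin (m + d + 1))).succ.succ = 1 := by simp [hg]
  have hgC : ∀ j : Fin (B - m),
      g (Fin.castAdd (m + d + 1) j).succ.succ = (Fin.castAdd d (ψ (Sum.inl j))).succ.succ.succ :=
    fun j => by simp [hg]
  have hgS : ∀ l : Fin m, g (Fin.natAdd (B - m) (Fin.castAdd d l).succ).succ.succ =
      (Fin.castAdd d (ψ (Sum.inr l))).succ.succ.succ := fun l => by simp [hg]
  have hgw : ∀ i : Fin d, g (Fin.natAdd (B - m) (Fin.natAdd m i).succ).succ.succ =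
      (Fin.natAdd B i).succ.succ.succ := fun i => by simp [hg]
  -- it is surjective, hence bijective
  have hsurj : Function.Surjective g := by
    intro x
    induction x using Fin.cases with
    | zero => exact ⟨0, hg0⟩
    | succ x =>
      induction x using Fin.cases with
      | zero => exact ⟨_, by rw [hgs, Fin.succ_zero_eq_one]⟩
      | succ x =>
        induction x using Fin.cases with
        | zero => exact ⟨1, by rw [hg1]; rfl⟩
        | succ x =>
          induction x using Fin.addCases with
          | left j =>
            obtain ⟨y, rfl⟩ := ψ.surjective j
            rcases y with j | l
            · exact ⟨_, hgC j⟩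
            · exact ⟨_, hgS l⟩
          | right i => exact ⟨_, hgw i⟩
  have hbij : Function.Bijective g :=
    (Fintype.bijective_iff_surjective_and_card g).mpr
      ⟨hsurj, by simp only [Fintype.card_fin]; omega⟩
  refine ⟨(Equiv.ofBijective g hbij).symm, ?_, ?_, ?_, fun j => ?_, fun l => ?_, fun i => ?_⟩ <;>
    rw [Equiv.symm_apply_eq, Equiv.ofBijective_apply]
  · exact hg0.symm
  · exact hgs.symm
  · exact hg1.symm
  · exact (hgC j).symm
  · exact (hgS l).symm
  · exact (hgw i).symm

/-! ## The stub -/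

/-- **Stub `stub_blowup_sorted` (a typed piece of type `S` is an elementary product over the fibre
representation).** Let `R` be the typed blow-up family of type `S` over `(p, q, B, d, r)`
(`#S = m`; `t j ∈ [s', 1]` for `j ∈ S`, `t j ∈ [σ, 1]` for `j ∉ S`) and `W` the fibre
representation with coordinates `(s', η, x)` (`0 < s' < 1`, `s' ≤ η l ≤ 1`, `x ∈ r.domain`,
integrand `s' ^ (1 - p/q) · ∏ (η l)⁻¹ · r(x)`). Then there is an elementary divergent product `P'`
with data `(p, q, B - m, W)` and `[R] − [P'] ∈ KZ.fibredRelations`: `P' := R.reindex e` for the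
relabelling `e` of `exists_blowupSortedEquiv` (which fixes the parameter index `0`, a fibred move by
`of_sub_of_reindex_mem_fibredRelations_of_pos`); its domain and integrand are those of the
elementary product on the nose (coordinate forms `blowupTypedDomainAC_eq`, `elementaryDomain_eq`,
`monomialDomain_eq`; `σ ^ 0 s' ^ 1 = s'`, `σ ^ 1 s' ^ 0 = σ`; the block product splits along the
sorting `Fin (B - m) ⊕ Fin m ≃ Fin B`). [Kontsevich–Zagier 2001, §1.2 rule (2)] [folklore] -/
theorem stub_blowup_sorted : ∀ (p q B d : ℕ) (r : Literature.NumberTheory.Transcendental.KZ.IntegralRep d) (m : ℕ) (S : Finset (Fin B)) (R : Literature.NumberTheory.Transcendental.KZ.IntegralRep (B + d + 1 + 1 + 1)) (W : Literature.NumberTheory.Transcendental.KZ.IntegralRep (m + d + 1)), S.card = m → R.domain = {z | ∃ (σ s' v : ℝ) (t : Fin B → ℝ) (w : Fin d → ℝ), z = Matrix.vecCons σ (Matrix.vecCons s' (Matrix.vecCons v (Fin.append t w))) ∧ 0 < σ ∧ σ < 1 ∧ 0 < s' ∧ s' < 1 ∧ 0 < v ∧ v ^ q * σ ^ p < 1 ∧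 (∀ j, σ ^ (if j ∈ S then 0 else 1) * s' ^ (if j ∈ S then 1 else 0) ≤ t j ∧ t j ≤ 1) ∧ w ∈ r.domain} → R.integrand = (fun z => z 1 ^ ((1 - (p : ℚ) / q : ℚ) : ℝ) * ((∏ j : Fin B, (z (Fin.castAdd d j).succ.succ.succ)⁻¹) * r.integrand (fun l : Fin d => z (Fin.natAdd B l).succ.succ.succ))) → W.domain = {v | ∃ (s' : ℝ) (η : Fin m → ℝ) (x : Fin d → ℝ), v = Matrix.vecCons s' (Fin.append η x) ∧ 0 < s' ∧ s' < 1 ∧ (∀ l, s' ≤ η l ∧ η l ≤ 1) ∧ x ∈ r.domain} → W.integrand = (fun v => v 0 ^ ((1 - (p : ℚ) / q : ℚ) : ℝ) * ((∏ l : Fin m, (v (Fin.castAdd d l).succ)⁻¹) * r.integrand (fun i : Fin d => v (Fin.natAdd m i).succ))) → ∃ P' : Literature.NumberTheory.Transcendental.KZ.IntegralRep ((B - m) + (m + d + 1) + 1 + 1), P'.domain = {z | ∃ (s u : ℝ) (y : Fin (B - m) → ℝ) (w : Fin (m + d + 1) → ℝ), z = Matrix.vecCons s (Matrix.vecCons u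 (Fin.append y w)) ∧ 0 < s ∧ s < 1 ∧ 0 < u ∧ u ^ q * s ^ p < 1 ∧ (∀ j, s ≤ y j ∧ y j ≤ 1) ∧ w ∈ W.domain} ∧ P'.integrand = (fun z => (∏ j : Fin (B - m), (z (Fin.castAdd (m + d + 1) j).succ.succ)⁻¹) * W.integrand (fun l : Fin (m + d + 1) => z (Fin.natAdd (B - m) l).succ.succ)) ∧ Literature.NumberTheory.Transcendental.KZ.of R - Literature.NumberTheory.Transcendental.KZ.of P' ∈ Literature.NumberTheory.Transcendental.KZ.fibredRelations := by
  intro p q B d r m S R W hm hRd hRi hWd hWi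
  -- coordinate forms of the two given domains
  replace hRd := hRd.trans (blowupTypedDomainAC_eq q p B (fun j => if j ∈ S then 0 else 1)
    (fun j => if j ∈ S then 1 else 0) r)
  replace hWd := hWd.trans (monomialDomain_eq m r)
  -- sort the block: `ψ (inl _) ∉ S`, `ψ (inr _) ∈ S`, and relabel the coordinates accordingly
  obtain ⟨ψ, hψC, hψS⟩ := exists_sumEquiv_finsetCompl S hm
  obtain ⟨e, he0, he1, he2, heC, heS, hew⟩ := exists_blowupSortedEquiv d ψ
  refine ⟨R.reindex e, ?_, ?_,
    of_sub_of_reindex_mem_fibredRelations_of_pos (by omega) R e (by simp [he0])⟩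
  · -- the domains agree: compare coordinate forms
    rw [IntegralRep.reindex_domain, hRd, elementaryDomain_eq p q (B - m) W, hWd]
    ext z
    simp only [mem_setOf_eq, he0, he1, he2, hew]
    constructor
    · rintro ⟨h0, h1, hs, hs1, hv, hvq, ht, hw⟩
      refine ⟨h0, h1, hv, hvq, fun j => ?_, hs, hs1, fun l => ?_, hw⟩
      · have h := ht (ψ (Sum.inl j))
        rwa [heC j, if_neg (hψC j), if_neg (hψC j), pow_one, pow_zero, mul_one] at h
      · have h := ht (ψ (Sum.inr l))
        rwa [heS l, if_pos (hψS l), if_pos (hψS l), pow_zero, pow_one, one_mul] at h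
    · rintro ⟨h0, h1, hv, hvq, hy, hs, hs1, hη, hw⟩
      refine ⟨h0, h1, hs, hs1, hv, hvq, fun j' => ?_, hw⟩
      obtain ⟨x, rfl⟩ := ψ.surjective j'
      rcases x with j | l
      · rw [heC j, if_neg (hψC j), if_neg (hψC j), pow_one, pow_zero, mul_one]
        exact hy j
      · rw [heS l, if_pos (hψS l), if_pos (hψS l), pow_zero, pow_one, one_mul]
        exact hη l
  · -- the integrands agree everywhere
    rw [IntegralRep.reindex_integrand, hRi, hWi]
    funext z
    simp only [he1, hew]
    rw [← Equiv.prod_comp ψ, Fintype.prod_sum_type]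
    simp only [heC, heS]
    ring

end Summit.KontsevichZagierPeriods.ValuedFieldSpecialisation
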